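import Mathlib

/-!
# A2Positivity — a quadratic form plus a large multiple of a positive definite one is positive

Kernel-checked form of the CLAIM in Step 2 of Prop. A4.2.4 of route/T4-A2-p6.md (sub-claim
A2 of route/TIER4.md, cell pub-hodge-repro2): if `H_M` is a positive definite hermitian form
on the finite-dimensional complex vector space `V = Lie(X)` of an abelian variety and `H_L` is
any hermitian form, then `H_L + n H_M` is positive definite for some integer `n ≥ 1`; this is
what makes `L ⊗ M^{⊗n}` a positive (hence ample) line bundle.

Formalised in the real form that the argument uses: `E` is a finite-dimensional real inner
product space (the inner product `Re H_M`, whose norm is `‖v‖ = H_M(v, v)^{1/2}`), and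
`q : E → ℝ` is continuous and `2`-homogeneous (`q (r • v) = r ^ 2 * q v`; for
`q v = H_L(v, v)`, real since `H_L` is hermitian).  Then `q v + n * ‖v‖ ^ 2 > 0` for all
`v ≠ 0` and some `n : ℕ`.  The proof is the one printed: `q` is bounded below on the compact
unit sphere (`isCompact_sphere`, `IsCompact.exists_isMinOn`) and scaling gives the bound
`q v ≥ c ‖v‖ ^ 2`.
-/

namespace Summit.Ventures.HodgeRepro2.A2Positivity

variable {E : Type*} [NormedAddCommGroup E] [InnerProductSpace ℝ E] [FiniteDimensional ℝ E]

omit [FiniteDimensional ℝ E] in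
/-- Scaling a non-zero vector to the unit sphere. -/
theorem inv_norm_smul_mem_sphere (v : E) (hv : v ≠ 0) :
    ‖v‖⁻¹ • v ∈ Metric.sphere (0 : E) 1 := by
  have hnorm : ‖v‖ ≠ 0 := norm_ne_zero_iff.mpr hv
  simp [norm_smul, hnorm]

/-- **Positivity after adding a large multiple of the norm** (Prop. A4.2.4, Step 2, CLAIM).
For a continuous `2`-homogeneous `q` on a finite-dimensional real inner product space there is
`n : ℕ` with `q v + n * ‖v‖ ^ 2 > 0` for every `v ≠ 0`. -/
theorem exists_nat_add_norm_sq_pos (q : E → ℝ) (hq : Continuous q)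
    (hhom : ∀ (r : ℝ) (v : E), q (r • v) = r ^ 2 * q v) :
    ∃ n : ℕ, ∀ v : E, v ≠ 0 → 0 < q v + n * ‖v‖ ^ 2 := by
  by_cases hS : (Metric.sphere (0 : E) 1).Nonempty
  · obtain ⟨s₀, hs₀, hmin⟩ := (isCompact_sphere (0 : E) 1).exists_isMinOn hS hq.continuousOn
    obtain ⟨n, hn⟩ := exists_nat_gt (-(q s₀))
    refine ⟨n, fun v hv => ?_⟩
    have hnorm : ‖v‖ ≠ 0 := norm_ne_zero_iff.mpr hv
    have hnormpos : 0 < ‖v‖ := norm_pos_iff.mpr hv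
    have hsS : ‖v‖⁻¹ • v ∈ Metric.sphere (0 : E) 1 := inv_norm_smul_mem_sphere v hv
    have hvs : v = ‖v‖ • (‖v‖⁻¹ • v) := by
      rw [smul_smul, mul_inv_cancel₀ hnorm, one_smul]
    have hq_v : q v = ‖v‖ ^ 2 * q (‖v‖⁻¹ • v) := by
      conv_lhs => rw [hvs]
      exact hhom _ _
    have hlow : q s₀ ≤ q (‖v‖⁻¹ • v) := hmin hsS
    have hsq : 0 < ‖v‖ ^ 2 := by positivity
    have key : 0 < q s₀ + n := by linarith
    calc (0 : ℝ) < ‖v‖ ^ 2 * (q s₀ + n) := mul_pos hsq key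
      _ ≤ ‖v‖ ^ 2 * (q (‖v‖⁻¹ • v) + n) := by
          apply mul_le_mul_of_nonneg_left _ hsq.le
          linarith
      _ = q v + n * ‖v‖ ^ 2 := by rw [hq_v]; ring
  · -- the unit sphere is empty: there is no non-zero vector at all
    refine ⟨0, fun v hv => ?_⟩
    exact absurd ⟨‖v‖⁻¹ • v, inv_norm_smul_mem_sphere v hv⟩ hS

end Summit.Ventures.HodgeRepro2.A2Positivity
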